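import Summits.QuantumAdvantage.QuantumAdvantage.Theorems.CoSupportLawB
import Summits.QuantumAdvantage.QuantumAdvantage.Theorems.InnerDegreeLawsD

set_option linter.dupNamespace false

/-!
# LAW I (co-support law), part C — LAW I on a subcube (unifies LAW I with LAW C / LAW Q / LAW C⁺)

* `loss_of_coSupport_subcube`: on a subcube `fill ρ T ·` registers = tables of `k` forms of the free bits × a core ignoring `≥ m₁` of the
  free coordinates (per register) ⇒ loss on the subcube once `(n+1)·2p^k·|W|·(2p−1)^{m₁} < (2p)^{m₁}`;
* `quadVal_fill_quad`: a quadratic form restricted to a subcube = constant + quadratic form of the free bits with the `T × T` block;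
* `loss_of_quadCoSupport_subcube`: `QuadForm` registers whose `T × T` blocks each leave `≥ m₁` free coordinates isolated ⇒ loss on the
  subcube (LAW Q = all blocks empty; `T = id` = `loss_of_quadCoSupport`).
-/

open Finset
open Summit.QuantumAdvantage.AdviceFreeQNC0
open Summit.QuantumAdvantage.AdviceFreeQNC0.Coset21.CharTwoKill

namespace Summit.QuantumAdvantage.QuantumAdvantage.Theorems.CoSupportDial

/-! ### §5b LAW I on a subcube (unifies LAW I with LAW C / LAW Q / LAW C⁺: per-register free coordinates INSIDE one common subcube) -/

section Subcube

variable {p : ℕ} [Fact p.Prime]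

/-- **LAW I on a subcube.**  On the subcube `fill ρ T ·` (free coordinates `T : Fin m ↪ Fin n`, frozen bits `ρ`) let every register be a
table of `k` linear forms `mod p` of the free bits and of a core `N g v ∈ W` ignoring the free coordinates in `free g ⊆ Fin m`, with
`|free g| ≥ m₁`; if `(n+1)·2p^k·|W|·(2p−1)^{m₁} < (2p)^{m₁}` the strategy loses ON THE SUBCUBE — for every charge, with nothing assumed
off the subcube.  `T = id` is `loss_of_coSupport`; `free g = univ, W = Unit` is LAW C `InnerDegreeDial.loss_on_kForm_subcube`. -/
theorem loss_of_coSupport_subcube (hp5 : 5 ≤ p) {n m k m₁ : ℕ} {W : Type*} [Fintype W] [DecidableEq W] (hm : m₁ ≤ m)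
    (hcount : (n + 1) * (p ^ k * Fintype.card W * 2) * (2 * p - 1) ^ m₁ < (2 * p) ^ m₁) (c : ℕ)
    (y : Fin (n + 1) → (Fin n → Bool) → Bool) (ρ : Fin n → Bool) (T : Fin m ↪ Fin n)
    (lam : Fin (n + 1) → Fin k → Fin m → ZMod p) (N : Fin (n + 1) → (Fin m → Bool) → W)
    (F : Fin (n + 1) → (Fin k → ZMod p) → W → Bool)
    (hy : ∀ g v, y g (InnerDegreeDial.fill ρ T v) = F g (fun j => ∑ i, if v i = true then lam g j i else 0) (N g v))
    (free : Fin (n + 1) → Finset (Fin m)) (hN : ∀ g, ∀ i ∈ free g, ∀ v b, N g (Function.update v i b) = N g v)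
    (hfree : ∀ g, m₁ ≤ (free g).card) :
    ∃ v, ringWinU c y (InnerDegreeDial.fill ρ T v) = false := by
  classical
  obtain ⟨hK, ω, ζ, hω, hζ⟩ := Coset21.exists_charTwo_roots p hp5
  haveI := hK
  have hp0 : 0 < 2 * p := by omega
  have hcount' : Fintype.card (Fin (n + 1)) * (p ^ k * Fintype.card W * 2) * ((2 * p - 1) ^ m₁ * (2 * p) ^ (m - m₁))
      < (2 * p) ^ m := by
    rw [Fintype.card_fin]; exact count_pad hp0 hm hcount
  obtain ⟨v, hv⟩ := abstract_even_existsC ω ζ hω lam N F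
    (fun g : Fin (n + 1) => c + g.val + InnerDegreeDial.frozenExp ρ T g.val)
    (fun (g : Fin (n + 1)) (j : Fin m) => ww g.val (T j)) hp5 hζ (fun g j => ww_mem g.val (T j)) free hN m₁ hfree hcount'
  refine ⟨v, ?_⟩
  rw [Bool.eq_false_iff]
  intro hwin
  simp only [ringWinU, decide_eq_true_eq] at hwin
  have hfilter : (univ.filter fun g : Fin (n + 1) =>
        y g (InnerDegreeDial.fill ρ T v) = true ∧ (c + g.val + walkExp (InnerDegreeDial.fill ρ T v) g.val) % 3 ≠ 0)
      = (univ.filter fun g : Fin (n + 1) =>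
          F g (kForm lam g v) (N g v) = true ∧
            ((c + g.val + InnerDegreeDial.frozenExp ρ T g.val) +
              wForm (fun (g' : Fin (n + 1)) (j : Fin m) => ww g'.val (T j)) g v) % 3 ≠ 0) := by
    refine filter_congr fun g _ => ?_
    rw [hy g v, InnerDegreeDial.walkExp_fill]
    unfold kForm wForm
    simp only [add_assoc]
  rw [hfilter] at hwin
  omega

/-- on a subcube a quadratic form is a constant plus a quadratic form OF THE FREE BITS whose matrix is the `T × T` block -/
theorem quadVal_fill_quad {n m : ℕ} (M : Fin n → Fin n → ZMod p) (b : Fin n → ZMod p) (ρ : Fin n → Bool) (T : Fin m ↪ Fin n) :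
    ∃ (C : ZMod p) (β : Fin m → ZMod p), ∀ v,
      InnerDegreeDial.quadVal M b (InnerDegreeDial.fill ρ T v) = C + InnerDegreeDial.quadVal (fun j j' => M (T j) (T j')) β v := by
  classical
  obtain ⟨C, β, hCβ⟩ :=
    InnerDegreeDial.quadVal_fill_affine (InnerDegreeDial.blockOff M T) b ρ T (InnerDegreeDial.blockOff_T M T)
  refine ⟨C, β, fun v => ?_⟩
  rw [InnerDegreeDial.quadVal_fill_block, hCβ v]
  unfold InnerDegreeDial.quadVal
  abel

/-- **LAW I on a subcube, quadratic grade.**  `QuadForm` registers on the whole cube; if on some subcube `fill ρ T ·` with `m` free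
coordinates EVERY register's `T × T` block leaves `≥ m₁` of the free coordinates isolated (`freeOf` of the block: no off-diagonal entry in
their row or column of the block) and `(n+1)·2p^{k+2}·(2p−1)^{m₁} < (2p)^{m₁}`, the strategy loses on that subcube.  All blocks empty
(`m₁ = m`) is LAW Q `InnerDegreeDial.loss_of_quadTests`; `T = id` is `loss_of_quadCoSupport`; LAW C⁺ `loss_of_sparseQuad` (blocks touching
`r` positions, price `p^r`) and this law (≥ m₁ untouched positions, price nothing) are the two ways to pay for a surviving block. -/
theorem loss_of_quadCoSupport_subcube (hp5 : 5 ≤ p) {n m k m₁ : ℕ} (hm : m₁ ≤ m)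
    (hcount : (n + 1) * (p ^ (k + 1) * p * 2) * (2 * p - 1) ^ m₁ < (2 * p) ^ m₁) (c : ℕ)
    (y : Fin (n + 1) → (Fin n → Bool) → Bool)
    (lam : Fin (n + 1) → Fin k → Fin n → ZMod p) (M : Fin (n + 1) → Fin n → Fin n → ZMod p)
    (b : Fin (n + 1) → Fin n → ZMod p) (F : Fin (n + 1) → (Fin k → ZMod p) → ZMod p → Bool)
    (hy : ∀ g u, y g u = F g (fun j => ∑ i, if u i = true then lam g j i else 0) (InnerDegreeDial.quadVal (M g) (b g) u))
    (ρ : Fin n → Bool) (T : Fin m ↪ Fin n)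
    (hfree : ∀ g, m₁ ≤ (freeOf (fun j j' => M g (T j) (T j'))).card) :
    ∃ v, ringWinU c y (InnerDegreeDial.fill ρ T v) = false := by
  classical
  choose C β hCβ using fun g => quadVal_fill_quad (M g) (b g) ρ T
  -- frozen constants of the `k` forms
  let α : Fin (n + 1) → Fin k → ZMod p := fun g j => ∑ i ∈ (univ.map T)ᶜ, if ρ i = true then lam g j i else 0
  -- the `k+1` forms of the free bits: the restricted forms, then the diagonal-plus-`β` form of the block
  let lam' : Fin (n + 1) → Fin (k + 1) → Fin m → ZMod p :=
    fun g => Fin.snoc (α := fun _ => Fin m → ZMod p) (fun j j' => lam g j (T j')) (fun j' => M g (T j') (T j') + β g j')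
  let F' : Fin (n + 1) → (Fin (k + 1) → ZMod p) → ZMod p → Bool :=
    fun g x q => F g (fun j => α g j + x (Fin.castSucc j)) (C g + (q + x (Fin.last k)))
  have hcount' : (n + 1) * (p ^ (k + 1) * Fintype.card (ZMod p) * 2) * (2 * p - 1) ^ m₁ < (2 * p) ^ m₁ := by
    rw [ZMod.card]; exact hcount
  refine loss_of_coSupport_subcube hp5 hm hcount' c y ρ T lam' (fun g v => offDiagVal (fun j j' => M g (T j) (T j')) v) F'
    (fun g v => ?_) (fun g => freeOf (fun j j' => M g (T j) (T j'))) (fun g i hi v c' => offDiagVal_update _ hi v c') hfree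
  rw [hy g, hCβ g v, quadVal_split]
  show F g _ _ = F g _ _
  congr 1
  · funext j
    rw [InnerDegreeDial.linForm_fill]
    simp [lam', α, Fin.snoc_castSucc]
  · simp [lam', Fin.snoc_last]

end Subcube

end Summit.QuantumAdvantage.QuantumAdvantage.Theorems.CoSupportDial
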